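import Literature.AnabelianGeometry.EtaleTheta.Discharge.Sec1DeltaXModClosureDtpY
import Literature.AnabelianGeometry.EtaleTheta.Discharge.Sec1FreeTwoKernelZHat
import Literature.AnabelianGeometry.EtaleTheta.SettingFreeProfinite
import Literature.AnabelianGeometry.SemiGraphs.TemperedThetaQuotients
import HarnessLib

/-!
# [EtTh] §1 p. 12: the closure of `Δ^tp_Y` in `Δ^ell_X` IS `Ẑ` (group structure) for EVERY
# `OncePuncturedTemperedGroup` — the hypothesis-free L3 shadow of FACT-LIST F-1697

Mochizuki, *The étale theta function and its Frobenioid-theoretic manifestations*, Publ. RIMS **45** (2009)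
[EtTh], §1, PRIMS PDF p. 12 (printed 238): "`1 → Ẑ(1) → Δ^ell_X → Ẑ → 1`", "Thus, `(Δ^tp_Y)^ell` … `≅ Ẑ(1)`"
[cite: MochizukiEtTh2009, §1 p.12].  Layer L2 of the abc-iut cell, seat abc-iut-L2-t7 (gen 3); PROOF-ONLY (no
`def`, no `instance`, no named fact); read-only consumer of abc-iut-L3's frozen interface
(`OncePuncturedTemperedGroup`, `DeltaEll`, `ellKerHat`).

FACT-LIST F-1697 `DeltaYEllClosureIsoTate Ω` says: the subgroup `T ≤ Δ^ell_X` whose carrier is the closure of the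
image of `Δ^tp_Y` is a `Π^tp_X`-stable TATE TWIST `Ẑ(1)`.  This file PROVES its group-structure content with NO
origin binder (freeness of `Δ_X` is the interface field `deltaHat_free`, not a hypothesis), for `K : Type`:
* `DeltaEllZHat.exists_hom_closureDeltaY_zHat` — a SURJECTION `(ι Δ^tp_Y)⁻ ↠ Ẑ` with kernel exactly
  `[Δ_X,Δ_X]⁻ ∩ (ι Δ^tp_Y)⁻` (abc-iut-w5-d024's generic `IsFreeProfiniteOnTwo.exists_hom_kerInf_commutatorClosure_zHat`
  at the profinite completion `Λ : Π_X → Ẑ` of `Π^tp_X ↠ Z` from `Sec1DeltaXModClosureDtpY.lean`, whose kernel on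
  `Δ_X` is `(ι Δ^tp_Y)⁻`);
* `DeltaEllZHat.nonempty_closureDeltaY_quotient_mulEquiv_zHat` — `(ι Δ^tp_Y)⁻/([Δ_X,Δ_X]⁻ ∩ (ι Δ^tp_Y)⁻) ≃* Ẑ`;
* `DeltaEllZHat.nonempty_mulEquiv_zHat_of_coe_eq_closure` — **for ANY `T ≤ Δ^ell_X` whose carrier is the closure
  of the image of `Δ^tp_Y` (the carrier clause of F-1697), `T ≃* Ẑ`**.  So the honest residual of F-1697 is its
  `G_K`-ACTION clause alone (the Tate twist; cf. abc-iut-w6-d060's `¬∀` p431274 and the reductions F-0657/F-0659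
  ⟸ F-1697 of `Sec1DeltaEllExtensionOfClosure.lean` / `Sec1DeltaYEllIsoTateOfClosure.lean`).

HONEST FRAMING: [EtTh] is refereed; the interface is DATA quoting print, asserted for no curve; group structure
only; nothing bears on [IUTchIII] Cor. 3.12; typed ≠ proved elsewhere; no side is taken on any disputed claim.
-/

noncomputable section

namespace Literature.AnabelianGeometry.EtaleTheta

open Literature.AnabelianGeometry.SemiGraphs
open _root_.Topology
open scoped commutatorElement
open CategoryTheory ProfiniteGrp ProfiniteGrp.ProfiniteCompletion

namespace DeltaEllZHat

variable {K : Type} [Field K] (D : OncePuncturedTemperedGroup K)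

/-- **`(ι Δ^tp_Y)⁻ ↠ Ẑ` with kernel `[Δ_X,Δ_X]⁻`** ([EtTh] p. 12 "`(Δ^tp_Y)^ell ≅ Ẑ(1)`", group structure, for
EVERY `OncePuncturedTemperedGroup`): the closure `N` of the image of `Δ^tp_Y = Δ^tp_X ∩ Π^tp_Y` in `Π_X` is the
kernel on `Δ_X` of the profinite completion `Λ : Π_X → Ẑ` of `Π^tp_X ↠ Z`, and abc-iut-w5-d024's
"`Ker(F̂₂ ↠ Ẑ)/[F̂₂,F̂₂]⁻ ≅ Ẑ`" applies to the free profinite `Δ_X` (interface field `deltaHat_free`).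
[cite: MochizukiEtTh2009, §1 p.12] -/
theorem exists_hom_closureDeltaY_zHat :
    ∃ ρ : ↥((D.deltaY.map D.toHat.toMonoidHom).topologicalClosure) →* ZHat,
      Function.Surjective ρ ∧ ∀ x, ρ x = 1 ↔ (x : D.PiHat) ∈ D.ellKerHat := by
  classical
  have hι := D.isProfiniteCompletion_toHat
  haveI : CompactSpace D.PiHat := hι.compactSpace
  haveI : T2Space D.PiHat := hι.t2Space
  obtain ⟨Λ, hΛ⟩ := ClosureKerZHat.exists_hom_zHat hι D.zQuot D.isOpen_ker_zQuot
  -- `Δ^tp_X ↠ Z`: correct a preimage in `Π^tp_X` by a cusp decomposition group (`≤ Π^tp_Y`, onto `G_K`)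
  obtain ⟨σ, hσΔ, hσ⟩ : ∃ σ ∈ D.delta, D.zQuot σ = Multiplicative.ofAdd 1 := by
    obtain ⟨g, hg⟩ := D.zQuot_surjective (Multiplicative.ofAdd 1)
    obtain ⟨C, hC⟩ := D.cuspDecomp_nonempty
    have hmem : D.aug g ∈ (C.map D.aug.toMonoidHom : Subgroup (Field.absoluteGaloisGroup K)) := by
      rw [D.map_aug_eq_top_of_mem_cuspDecomp C hC]; exact Subgroup.mem_top _
    obtain ⟨d, hdC, hd⟩ := hmem
    refine ⟨g * d⁻¹, ?_, ?_⟩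
    · rw [TemperedArithmeticGroup.mem_delta_iff]
      have hd' : D.aug d = D.aug g := hd
      rw [map_mul, map_inv, hd', mul_inv_cancel]
    · have hdz : D.zQuot d = 1 := D.le_ker_of_mem_cuspDecomp C hC hdC
      rw [map_mul, map_inv, hdz, inv_one, mul_one, hg]
  have hker : Λ.toMonoidHom.ker ⊓ D.deltaHat = (D.deltaY.map D.toHat.toMonoidHom).topologicalClosure :=
    ClosureKerZHat.ker_inf_closure_map_eq hι hΛ D.delta ⟨σ, hσΔ, hσ⟩
  have h1 : ∃ x ∈ D.deltaHat, Λ x = etaFn (GrpCat.of (Multiplicative ℤ)) (Multiplicative.ofAdd (1 : ℤ)) :=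
    ⟨D.toHat σ, Subgroup.le_topologicalClosure _ ⟨σ, hσΔ, rfl⟩, by rw [hΛ σ, hσ]; rfl⟩
  obtain ⟨ρ, hρs, hρk⟩ := IsFreeProfiniteOnTwo.exists_hom_kerInf_commutatorClosure_zHat
    (isFreeProfiniteOnTwo_deltaHat D) D.isClosed_deltaHat Λ h1
  let e : ↥((D.deltaY.map D.toHat.toMonoidHom).topologicalClosure) ≃* ↥(Λ.toMonoidHom.ker ⊓ D.deltaHat) :=
    (MulEquiv.subgroupCongr hker).symm
  refine ⟨ρ.comp e.toMonoidHom, hρs.comp e.surjective, fun x => ?_⟩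
  rw [MonoidHom.comp_apply, MulEquiv.coe_toMonoidHom, hρk]
  rfl

/-- **`(ι Δ^tp_Y)⁻ / ([Δ_X,Δ_X]⁻ ∩ (ι Δ^tp_Y)⁻) ≅ Ẑ`** as abstract groups, for every `OncePuncturedTemperedGroup`
([EtTh] p. 12; the normality instance is `D.ellKerHat_normal.subgroupOf _`). [cite: MochizukiEtTh2009, §1 p.12] -/
theorem nonempty_closureDeltaY_quotient_mulEquiv_zHat
    [(D.ellKerHat.subgroupOf (D.deltaY.map D.toHat.toMonoidHom).topologicalClosure).Normal] :
    Nonempty (↥(D.deltaY.map D.toHat.toMonoidHom).topologicalClosure ⧸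
      D.ellKerHat.subgroupOf (D.deltaY.map D.toHat.toMonoidHom).topologicalClosure ≃* ZHat) := by
  obtain ⟨ρ, hρs, hρk⟩ := exists_hom_closureDeltaY_zHat D
  have hkerEq : ρ.ker = D.ellKerHat.subgroupOf (D.deltaY.map D.toHat.toMonoidHom).topologicalClosure := by
    ext x
    rw [MonoidHom.mem_ker, hρk x, Subgroup.mem_subgroupOf]
  exact ⟨(QuotientGroup.quotientMulEquivOfEq hkerEq).symm.trans (QuotientGroup.quotientKerEquivOfSurjective ρ hρs)⟩

/-- **The carrier clause of F-1697 already forces `T ≅ Ẑ`** ([EtTh] p. 12): for every `OncePuncturedTemperedGroup`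
and ANY subgroup `T ≤ Δ^ell_X = Δ_X/[Δ_X,Δ_X]⁻` whose carrier is the closure of the image of `Δ^tp_Y` (exactly the
set `DeltaYEllClosureIsoTate` names), `T ≃* Ẑ` as an abstract group — `T` is the image of `(ι Δ^tp_Y)⁻` (compact,
so the image is closed and equals the closure of the image of `Δ^tp_Y`), with kernel `[Δ_X,Δ_X]⁻ ∩ (ι Δ^tp_Y)⁻`.
[cite: MochizukiEtTh2009, §1 p.12] -/
theorem nonempty_mulEquiv_zHat_of_coe_eq_closure (T : Subgroup D.DeltaEll)
    (hT : (T : Set D.DeltaEll) = closure ((fun δ : D.delta =>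
      (QuotientGroup.mk ⟨D.toHat δ, Subgroup.le_topologicalClosure _ ⟨δ, δ.2, rfl⟩⟩ : D.DeltaEll)) ''
        {δ | (δ : D.Pi) ∈ D.piY})) :
    Nonempty (↥T ≃* ZHat) := by
  classical
  have hι := D.isProfiniteCompletion_toHat
  haveI : CompactSpace D.PiHat := hι.compactSpace
  haveI : T2Space D.PiHat := hι.t2Space
  set N : Subgroup D.PiHat := (D.deltaY.map D.toHat.toMonoidHom).topologicalClosure with hNdef
  have hNΔ : N ≤ D.deltaHat := Subgroup.topologicalClosure_mono (Subgroup.map_mono inf_le_left)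
  -- `ψ : N → Δ^ell_X`, `n ↦ [n]`
  let jN : ↥N →* ↥D.deltaHat := Subgroup.inclusion hNΔ
  let ψ : ↥N →* D.DeltaEll := (QuotientGroup.mk' (D.ellKerHat.subgroupOf D.deltaHat)).comp jN
  have hψ : ∀ n : ↥N, ψ n = QuotientGroup.mk (Subgroup.inclusion hNΔ n) := fun n => rfl
  have hψc : Continuous ψ :=
    (QuotientGroup.continuous_mk (N := D.ellKerHat.subgroupOf D.deltaHat)).comp
      (continuous_subtype_val.subtype_mk _)
  -- kernel of `ψ`
  have hψker : ∀ n : ↥N, ψ n = 1 ↔ (n : D.PiHat) ∈ D.ellKerHat := by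
    intro n
    rw [hψ, QuotientGroup.eq_one_iff, Subgroup.mem_subgroupOf]
    rfl
  -- the range of `ψ` is `T`
  haveI : IsClosed ((D.ellKerHat.subgroupOf D.deltaHat : Subgroup ↥D.deltaHat) : Set ↥D.deltaHat) := by
    have : ((D.ellKerHat.subgroupOf D.deltaHat : Subgroup ↥D.deltaHat) : Set ↥D.deltaHat) =
        Subtype.val ⁻¹' (D.ellKerHat : Set D.PiHat) := by
      ext y; simp [Subgroup.mem_subgroupOf]
    rw [this]
    exact (Subgroup.isClosed_topologicalClosure _).preimage continuous_subtype_val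
  have hrange : (ψ.range : Set D.DeltaEll) = (T : Set D.DeltaEll) := by
    rw [hT, MonoidHom.coe_range]
    apply le_antisymm
    · -- `ψ(N) ⊆ closure`: `N` is the closure (in the subspace `N`!) of the image of `Δ^tp_Y`
      rintro _ ⟨n, rfl⟩
      let S₀ : Set ↥N := {w | (w : D.PiHat) ∈ D.toHat '' ((D.deltaY : Subgroup D.Pi) : Set D.Pi)}
      have hnS : n ∈ closure S₀ := by
        rw [Topology.IsInducing.subtypeVal.closure_eq_preimage_closure_image]
        have hn : (n : D.PiHat) ∈ closure (D.toHat.toMonoidHom '' ((D.deltaY : Subgroup D.Pi) : Set D.Pi)) :=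
          n.2
        refine closure_mono ?_ hn
        rintro _ ⟨δ, hδ, rfl⟩
        exact ⟨⟨D.toHat δ, Subgroup.le_topologicalClosure _ ⟨δ, hδ, rfl⟩⟩, ⟨δ, hδ, rfl⟩, rfl⟩
      have himg := image_closure_subset_closure_image hψc ⟨n, hnS, rfl⟩
      refine closure_mono ?_ himg
      rintro _ ⟨w, ⟨δ, hδ, hw⟩, rfl⟩
      refine ⟨⟨δ, hδ.1⟩, hδ.2, ?_⟩
      show (QuotientGroup.mk _ : D.DeltaEll) = QuotientGroup.mk (Subgroup.inclusion hNΔ w)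
      congr 1
      exact Subtype.ext hw
    · -- `closure ⊆ ψ(N)`: the image of the compact `N` is closed and contains the image of `Δ^tp_Y`
      haveI : CompactSpace ↥N :=
        isCompact_iff_compactSpace.1 (Subgroup.isClosed_topologicalClosure _).isCompact
      have hclosed : IsClosed (Set.range ψ) := (isCompact_range hψc).isClosed
      refine closure_minimal ?_ hclosed
      rintro _ ⟨δ, hδ, rfl⟩
      refine ⟨⟨D.toHat δ, Subgroup.le_topologicalClosure _ ⟨δ, ⟨δ.2, hδ⟩, rfl⟩⟩, ?_⟩
      rfl
  have hrangeT : ψ.range = T := SetLike.coe_injective hrange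
  -- assemble: `T = range ψ ≅ N / Ker ψ`, `Ker ψ = Ker ρ`, `N / Ker ρ ≅ Ẑ`
  obtain ⟨ρ, hρs, hρk⟩ := exists_hom_closureDeltaY_zHat D
  have hkers : ψ.ker = ρ.ker := by
    ext n
    rw [MonoidHom.mem_ker, MonoidHom.mem_ker, hψker, hρk]
  exact ⟨((MulEquiv.subgroupCongr hrangeT).symm.trans (QuotientGroup.quotientKerEquivRange ψ).symm).trans
    ((QuotientGroup.quotientMulEquivOfEq hkers).trans (QuotientGroup.quotientKerEquivOfSurjective ρ hρs))⟩

end DeltaEllZHat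

end Literature.AnabelianGeometry.EtaleTheta

end
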